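import Summits.CriticalPhenomena.SAWScalingLimit.Theorems.SAWTotalPositivityCriticalBubbleBoundJoinDefs

/-!
# Line `docking-census-joining` for the crux `SAWTotalPositivity.CriticalBubbleBound`
(stmt-CriticalPhenomena-7117), JOIN-MASS programme: summability of the class series

Stub `join_tsum_cterm_ne_top` of the lead's skeleton (c6, join-mass wave 1). The ledger
`Docking.stub_ledgerBootstrap`, run on the SHIFTED class sequence `jterm n = cterm (n - 17)` (`n ≥ 17`,
else `0`), outputs geometric decay of its dyadic block masses `R'_i = blockMass jterm i`; this file turns
that into finiteness of the class series `Σ_n cterm n = Σ_N #(N-edge SAP classes) x_c^N` in `ℝ≥0∞`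
(the lex-rooted model of the polygon classes).

Proof: un-shift (`cterm n = jterm (n + 17)` and `Σ' n, f (n + 17) ≤ Σ' m, f m` by injectivity of
`n ↦ n + 17`), then dyadic regrouping `Σ_n t_n ≤ t_0 + Σ_i R_i(t)` in `ℝ≥0∞` for an ARBITRARY nonnegative
sequence `t` (the argument of the landed `Docking.tsum_term_le`, made generic in `t`) and comparison with
the convergent geometric series `Σ_i C (2^s)^i`, `s < 0`.
-/

noncomputable section

open Literature.Probability.LatticeModels
open Literature.Probability.RandomPlanarGeometry Literature.Probability.RandomPlanarGeometry.SAW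
open scoped BigOperators ENNReal
open Summit.CriticalPhenomena.SAWScalingLimit.Theorems.CriticalBubbleBound.Negative (e₀)
open Summit.CriticalPhenomena.SAWScalingLimit.Theorems.CriticalBubbleBound.Docking

namespace Summit.CriticalPhenomena.SAWScalingLimit.Theorems.CriticalBubbleBound.Join

/-! ## Dyadic regrouping in `ℝ≥0∞` for an arbitrary nonnegative sequence -/

/-- Dyadic regrouping (inequality form) for an arbitrary nonnegative real sequence `t`:
`Σ_n t_n ≤ t_0 + Σ_i R_i(t)` in `ℝ≥0∞`, where `R_i(t) = blockMass t i = Σ_{n ∈ [2^i, 2^{i+1})} t_n`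
(every `n ≥ 1` lies in the block `B_{log₂ n}`). [folklore] -/
theorem tsum_ofReal_le_blockMass {t : ℕ → ℝ} (ht : ∀ n, 0 ≤ t n) :
    ∑' n : ℕ, ENNReal.ofReal (t n) ≤
      ENNReal.ofReal (t 0) + ∑' i : ℕ, ENNReal.ofReal (blockMass t i) := by
  -- adapted from Docking.tsum_term_le (DockingReduction), `term ↦ t`
  classical
  have hpt : ∀ n : ℕ, ENNReal.ofReal (t n) ≤
      (if n = 0 then ENNReal.ofReal (t 0) else 0) +
        ∑' i : ℕ, ((block i : Set ℕ).indicator fun m => ENNReal.ofReal (t m)) n := by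
    intro n
    by_cases hn : n = 0
    · subst hn
      simp only [if_true]
      exact le_self_add
    · rw [if_neg hn, zero_add]
      refine le_trans ?_ (ENNReal.le_tsum (Nat.log 2 n))
      rw [Set.indicator_of_mem (Finset.mem_coe.2 (mem_block_log hn))]
  calc ∑' n : ℕ, ENNReal.ofReal (t n)
      ≤ ∑' n : ℕ, ((if n = 0 then ENNReal.ofReal (t 0) else 0) +
          ∑' i : ℕ, ((block i : Set ℕ).indicator fun m => ENNReal.ofReal (t m)) n) :=
        ENNReal.tsum_le_tsum hpt
    _ = ENNReal.ofReal (t 0) +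
          ∑' n : ℕ, ∑' i : ℕ, ((block i : Set ℕ).indicator fun m => ENNReal.ofReal (t m)) n := by
        rw [ENNReal.tsum_add, tsum_ite_eq]
    _ = ENNReal.ofReal (t 0) +
          ∑' i : ℕ, ∑' n : ℕ, ((block i : Set ℕ).indicator fun m => ENNReal.ofReal (t m)) n := by
        rw [ENNReal.tsum_comm]
    _ = ENNReal.ofReal (t 0) + ∑' i : ℕ, ∑ n ∈ block i, ENNReal.ofReal (t n) := by
        congr 1
        refine tsum_congr fun i => ?_
        rw [sum_eq_tsum_indicator]
    _ = ENNReal.ofReal (t 0) + ∑' i : ℕ, ENNReal.ofReal (blockMass t i) := by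
        congr 1
        refine tsum_congr fun i => ?_
        rw [blockMass, ENNReal.ofReal_sum_of_nonneg fun n _ => ht n]

/-- Geometric decay `R_i(t) ≤ C 2^{s i}` (`s < 0`) of the dyadic block masses of a nonnegative real
sequence `t` makes its series finite in `ℝ≥0∞`: `Σ_n t_n ≤ t_0 + Σ_i C (2^s)^i < ∞`. [folklore] -/
theorem tsum_ofReal_ne_top_of_blockMass_le {t : ℕ → ℝ} (ht : ∀ n, 0 ≤ t n)
    (h : ∃ C s : ℝ, s < 0 ∧ ∀ i : ℕ, blockMass t i ≤ C * (2 : ℝ) ^ (s * (i : ℝ))) :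
    ∑' n : ℕ, ENNReal.ofReal (t n) ≠ ⊤ := by
  -- adapted from Docking.tsum_term_ne_top (DockingReduction), `term ↦ t`
  obtain ⟨C, s, hs, hC⟩ := h
  refine ne_top_of_le_ne_top ?_ (tsum_ofReal_le_blockMass ht)
  refine ENNReal.add_ne_top.2 ⟨ENNReal.ofReal_ne_top, ?_⟩
  have hC0 : 0 ≤ C := by
    have h0 := hC 0
    simp only [Nat.cast_zero, mul_zero, Real.rpow_zero, mul_one] at h0
    exact le_trans (blockMass_nonneg ht 0) h0
  have hq0 : 0 ≤ (2 : ℝ) ^ s := Real.rpow_nonneg (by norm_num) s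
  have hq1 : (2 : ℝ) ^ s < 1 := Real.rpow_lt_one_of_one_lt_of_neg (by norm_num) hs
  have hpow : ∀ i : ℕ, (2 : ℝ) ^ (s * (i : ℝ)) = ((2 : ℝ) ^ s) ^ i := fun i => by
    rw [Real.rpow_mul (by norm_num : (0 : ℝ) ≤ 2), Real.rpow_natCast]
  have hsum : Summable fun i : ℕ => C * (2 : ℝ) ^ (s * (i : ℝ)) := by
    simp_rw [hpow]
    exact (summable_geometric_of_lt_one hq0 hq1).mul_left C
  have hnn : ∀ i : ℕ, 0 ≤ C * (2 : ℝ) ^ (s * (i : ℝ)) := fun i =>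
    mul_nonneg hC0 (Real.rpow_nonneg (by norm_num) _)
  have hle : ∑' i : ℕ, ENNReal.ofReal (blockMass t i) ≤
      ∑' i : ℕ, ENNReal.ofReal (C * (2 : ℝ) ^ (s * (i : ℝ))) :=
    ENNReal.tsum_le_tsum fun i => ENNReal.ofReal_le_ofReal (hC i)
  refine ne_top_of_le_ne_top ?_ hle
  rw [← ENNReal.ofReal_tsum_of_nonneg hnn hsum]
  exact ENNReal.ofReal_ne_top

/-! ## Un-shifting the class sequence -/

/-- Un-shifting: `cterm n = jterm (n + 17)`. [folklore] -/
theorem cterm_eq_jterm_add (n : ℕ) : cterm n = jterm (n + joinShift) := by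
  rw [jterm_of_le (Nat.le_add_left _ _), Nat.add_sub_cancel]

/-- The class series is dominated by the shifted series, `Σ' n, cterm n ≤ Σ' m, jterm m` in `ℝ≥0∞`
(`n ↦ n + 17` is injective; in fact equality holds since `jterm` vanishes below `17`). [folklore] -/
theorem tsum_cterm_le_tsum_jterm :
    ∑' n : ℕ, ENNReal.ofReal (cterm n) ≤ ∑' m : ℕ, ENNReal.ofReal (jterm m) :=
  calc ∑' n : ℕ, ENNReal.ofReal (cterm n)
      = ∑' n : ℕ, ENNReal.ofReal (jterm (n + joinShift)) :=
        tsum_congr fun n => by rw [cterm_eq_jterm_add]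
    _ ≤ ∑' m : ℕ, ENNReal.ofReal (jterm m) :=
        ENNReal.tsum_comp_le_tsum_of_injective (add_left_injective joinShift)
          (fun m => ENNReal.ofReal (jterm m))

/-! ## The stub -/

/-- **Stub `join_tsum_cterm_ne_top`** (line `docking-census-joining`, JOIN-MASS programme, crux
stmt-CriticalPhenomena-7117; registered sub-goal of the lead's skeleton): geometric decay of the dyadic
block masses `R'_i = blockMass jterm i` of the shifted class sequence makes the class series
`Σ_n cterm n` finite in `ℝ≥0∞`. Proof: `Σ' cterm ≤ Σ' jterm` (un-shift by `17`), then dyadic regrouping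
and a geometric series (`tsum_ofReal_ne_top_of_blockMass_le` with `t = jterm ≥ 0`). [folklore] -/
theorem join_tsum_cterm_ne_top : (∃ C s : ℝ, s < 0 ∧ ∀ i : ℕ, blockMass jterm i ≤ C * (2 : ℝ) ^ (s * (i : ℝ))) → ∑' n : ℕ, ENNReal.ofReal (cterm n) ≠ ⊤ :=
  fun h => ne_top_of_le_ne_top (tsum_ofReal_ne_top_of_blockMass_le jterm_nonneg h)
    tsum_cterm_le_tsum_jterm

end Summit.CriticalPhenomena.SAWScalingLimit.Theorems.CriticalBubbleBound.Join

end
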